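import Literature.NumberTheory.Transcendental.KZKernelConjectureForms
import Summits.KontsevichZagierPeriods.KontsevichZagierPeriods.Theorems.CompleteModGammaSector.Negative.EulerGlue
import Literature.ModelTheory.ExponentialFields.OMinimalEulerInvariance

/-!
# `XMapKernel` (stmt-KontsevichZagierPeriods-10663), negative side: the Euler-weighted evaluation `J_g` (rules (1b), (2), (3) preserve it)

Part A.1 of finding F8 of the cdisprove work file `Cruxes/XMapKernel/Disproof.lean` (§6). On top of
the landed Euler-characteristic glue `Theorems/CompleteModGammaSector/Negative/EulerGlue.lean`
(`realEuler`, `E` of points / open / closed intervals of `ℝ¹`, the band lemma `realEuler_band`) this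
file adds: `E` of a half-open interval (`realEuler_Ioc = 0`) and of a ray (`realEuler_Ioi1 = −1`),
and the **Euler-weighted evaluation** `J_g [σ, f] := g(E(σ)) · ∫_σ f` for an ARBITRARY weight
`g : ℤ → ℝ` — the common generalisation of `KZ.eval` (`g ≡ 1`), of the landed parity invariant
`CompleteModGammaSectorNegative.evenEulerEval` (`g = 𝟙_{even}`, `Negative/DomainAdditivity.lean` of
that crux) and of `domainEuler`-type invariants. Rules (1b) and (3) of [Kontsevich–Zagier 2001, §1.2]
preserve `J_g` unconditionally, rule (2) modulo van den Dries Ch. 4 (2.4) (tree fact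
`Dries1998_ch4_prop_2_4`): `closure_withoutDomainAdd_le_ker`. The freedom in `g` is what the x-map
sector needs: the real loci `{x³+Ax+B > 0}` have `E ∈ {−1, −2}` of BOTH parities, so only a weight
vanishing on `{−1, −2}` — e.g. `g = 𝟙_{0}` (`Negative/CubicLocusEuler.lean`) — kills the x-map
relators of the crux.

Sources: M. Kontsevich, D. Zagier, *Periods* (2001), §1.2; L. van den Dries, *Tame topology and
o-minimal structures* (1998), Ch. 3 (2.3), Ch. 4 (2.1)–(2.4), (2.9)–(2.11). -/

noncomputable section

namespace Summit.KontsevichZagierPeriods.XMapKernel.Negative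

open MeasureTheory Set
open FirstOrder FirstOrder.Language
open Literature.NumberTheory.Transcendental
open Literature.ModelTheory.ExponentialFields
open Literature.ModelTheory.ExponentialFields.CellDimension
open Summit.KontsevichZagierPeriods.CompleteModGammaSectorNegative
  (realEuler isOMinimal_real definable_univ_of_isSemialgebraic definable_lt_real realEuler_point realEuler_Ioo
    realEuler_Icc realEuler_band)

/-! ### §1 Three more Euler characteristics in `ℝ¹`: open interval (definability), half-open interval, ray -/

/-- The open interval `{a < x < b} ⊆ ℝ¹` is definable (for any real `a, b`). [folklore] -/
theorem definable_Ioo1 (a b : ℝ) :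
    (univ : Set ℝ).Definable Language.orderedRing {y : Fin 1 → ℝ | a < y 0 ∧ y 0 < b} := by
  rcases lt_or_ge a b with hab | hab
  · have hcell := isCell_box (L := Language.orderedRing) (M := ℝ) definable_lt_real (fun _ : Fin 1 => a)
      (fun _ => b) (fun _ => hab)
    have hset : {v : Fin 1 → ℝ | ∀ i, (fun _ : Fin 1 => a) i < v i ∧ v i < (fun _ : Fin 1 => b) i} =
        {y : Fin 1 → ℝ | a < y 0 ∧ y 0 < b} := by
      ext v
      simp [Fin.forall_fin_one]
    rw [hset] at hcell
    exact hcell.definable definable_lt_real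
  · have hset : {y : Fin 1 → ℝ | a < y 0 ∧ y 0 < b} = ∅ := by
      ext y
      simp only [mem_setOf_eq, mem_empty_iff_false, iff_false, not_and, not_lt]
      intro h
      exact hab.trans h.le
    rw [hset]
    exact definable_of_finite Set.finite_empty

/-- The point `{x = c} ⊆ ℝ¹` is definable. [folklore] -/
theorem definable_point1 (c : ℝ) : (univ : Set ℝ).Definable Language.orderedRing {y : Fin 1 → ℝ | y 0 = c} := by
  have hfin : ({y : Fin 1 → ℝ | y 0 = c}).Finite := by
    have : {y : Fin 1 → ℝ | y 0 = c} = {fun _ => c} := by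
      ext y; simp only [mem_setOf_eq, mem_singleton_iff]
      constructor
      · intro h; funext i; rw [Fin.fin_one_eq_zero i]; exact h
      · intro h; rw [h]
    rw [this]; exact Set.finite_singleton _
  exact definable_of_finite hfin

/-- **`E(a, b] = 0`** for a half-open interval of `ℝ¹` (`a < b`): `E(a,b) + E{b} = −1 + 1`.
[cite: Dries1998, Ch. 4 (2.9)] -/
theorem realEuler_Ioc {a b : ℝ} (hab : a < b) :
    realEuler 1 {y : Fin 1 → ℝ | a < y 0 ∧ y 0 ≤ b} = 0 := by
  have hset : {y : Fin 1 → ℝ | a < y 0 ∧ y 0 ≤ b} = {y | a < y 0 ∧ y 0 < b} ∪ {y | y 0 = b} := by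
    ext y
    simp only [mem_setOf_eq, mem_union]
    constructor
    · rintro ⟨h1, h2⟩
      rcases h2.lt_or_eq with h2 | h2
      · exact Or.inl ⟨h1, h2⟩
      · exact Or.inr h2
    · rintro (⟨h1, h2⟩ | h)
      · exact ⟨h1, h2.le⟩
      · exact ⟨h ▸ hab, h.le⟩
  have hd : Disjoint {y : Fin 1 → ℝ | a < y 0 ∧ y 0 < b} {y | y 0 = b} :=
    Set.disjoint_left.mpr fun y hy hyb => by
      simp only [mem_setOf_eq] at hy hyb
      linarith [hy.2]
  rw [hset, realEuler, eulerChar_union isOMinimal_real definable_lt_real (definable_Ioo1 a b) (definable_point1 b) hd]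
  have e1 := realEuler_Ioo hab
  have e2 := realEuler_point b
  simp only [realEuler] at e1 e2
  rw [e1, e2]
  norm_num

/-- The ray `{e < x} ⊆ ℝ¹` is an open cell (band over `ℝ⁰` with lower bound `e`, no upper bound).
[cite: Dries1998, Ch. 3 (2.3)] -/
theorem isCell_Ioi1 (e : ℝ) : IsCell Language.orderedRing 1 (fun _ => true) {y : Fin 1 → ℝ | e < y 0} := by
  have h0 : IsCell Language.orderedRing 0 (fun _ : Fin 0 => true) (univ : Set (Fin 0 → ℝ)) :=
    isCell_zero_iff.mpr rfl
  have hband := h0.band (f := some fun _ => e) (g := none)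
    (fun f' hf' => by
      obtain rfl : f' = fun _ => e := by simpa using hf'.symm
      exact ⟨definableFun_const' _ _, continuousOn_const⟩)
    (by simp) (by simp)
  have hset : {v : Fin (0 + 1) → ℝ | (Fin.init v : Fin 0 → ℝ) ∈ (univ : Set (Fin 0 → ℝ)) ∧
      (∀ f' ∈ (some fun _ : Fin 0 → ℝ => e), f' (Fin.init v) < v (Fin.last 0)) ∧
      ∀ g' ∈ (none : Option ((Fin 0 → ℝ) → ℝ)), v (Fin.last 0) < g' (Fin.init v)} =
      {y : Fin 1 → ℝ | e < y 0} := by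
    ext v
    simp only [mem_univ, Option.mem_def, Option.some.injEq, forall_eq', true_and, mem_setOf_eq,
      reduceCtorEq, IsEmpty.forall_iff, implies_true, and_true]
    rfl
  rw [hset] at hband
  have hι : (Fin.snoc (fun _ : Fin 0 => true) true : Fin (0 + 1) → Bool) = fun _ => true := by
    funext i
    rw [Fin.fin_one_eq_zero i]
    rfl
  rw [hι] at hband
  exact hband

/-- **`E(e, ∞) = −1`**. [cite: Dries1998, Ch. 4 (2.1)] -/
theorem realEuler_Ioi1 (e : ℝ) : realEuler 1 {y : Fin 1 → ℝ | e < y 0} = -1 := by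
  have hcell := isCell_Ioi1 e
  rw [realEuler, eulerChar_cell isOMinimal_real definable_lt_real hcell,
    dim_eq_typeDim isOMinimal_real definable_lt_real hcell, typeDim_const_true]
  norm_num

/-- The ray is definable. [folklore] -/
theorem definable_Ioi1 (e : ℝ) : (univ : Set ℝ).Definable Language.orderedRing {y : Fin 1 → ℝ | e < y 0} :=
  (isCell_Ioi1 e).definable definable_lt_real

/-! ### §2 The Euler-weighted evaluation -/

/-- **The Euler-weighted evaluation** `J_g [σ, f] = g(E(σ)) · ∫_σ f`, extended additively to
`KZ.FormalRep`; generalises `KZ.eval` (`g ≡ 1`) and `CompleteModGammaSectorNegative.evenEulerEval`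
(`g = 𝟙_{even}`). [folklore] -/
def eulerWeightedEval (g : ℤ → ℝ) : KZ.FormalRep →+ ℝ :=
  FreeAbelianGroup.lift fun p => g (realEuler p.1 p.2.domain) * p.2.value

/-- `J_g` of a generator. [folklore] -/
@[simp] theorem eulerWeightedEval_of (g : ℤ → ℝ) {n : ℕ} (r : KZ.IntegralRep n) :
    eulerWeightedEval g (KZ.of r) = g (realEuler n r.domain) * r.value := by
  simp [eulerWeightedEval, KZ.of]

/-- Rule (1b) preserves `J_g`: the three domains coincide and the move is sound.
[cite: KontsevichZagier2001, §1.2 rule (1)] -/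
theorem eulerWeightedEval_eq_zero_of_mem_integrandAddRel (g : ℤ → ℝ) {c : KZ.FormalRep}
    (hc : c ∈ KZ.integrandAddRel) : eulerWeightedEval g c = 0 := by
  have h0 : KZ.eval c = 0 := KZ.eval_eq_zero_of_mem_integrandAddRel_holds hc
  obtain ⟨n, r, r₁, r₂, h₁, h₂, -, rfl⟩ := hc
  simp only [map_sub, KZ.eval_of] at h0
  simp only [map_sub, eulerWeightedEval_of, h₁, h₂]
  rw [← mul_sub, ← mul_sub, h0, mul_zero]

/-- Rule (3) preserves `J_g`: the band has the Euler characteristic of its base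
(`realEuler_band`, unconditionally) and the move is sound. [cite: KontsevichZagier2001, §1.2 rule (3)] -/
theorem eulerWeightedEval_eq_zero_of_mem_newtonLeibnizRel (g : ℤ → ℝ) {c : KZ.FormalRep}
    (hc : c ∈ KZ.newtonLeibnizRel) : eulerWeightedEval g c = 0 := by
  have h0 : KZ.eval c = 0 := KZ.eval_eq_zero_of_mem_newtonLeibnizRel_holds hc
  obtain ⟨n, r, r', a, b, F, -, -, -, hab, hdom, -, -, -, rfl⟩ := hc
  simp only [map_sub, KZ.eval_of, sub_eq_zero] at h0
  simp only [map_sub, eulerWeightedEval_of, realEuler_band r r' hab hdom, h0, sub_self]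

/-- Rule (2) preserves `J_g`, modulo van den Dries (2.4): `E(Φ σ) = E(σ)` for `Φ` semialgebraic and
injective on `σ`, and the move is sound. [cite: Dries1998, Ch. 4 (2.4)] -/
theorem eulerWeightedEval_eq_zero_of_mem_changeOfVariablesRel
    (hE : Dries1998_ch4_prop_2_4 Language.orderedRing ℝ) (g : ℤ → ℝ) {c : KZ.FormalRep}
    (hc : c ∈ KZ.changeOfVariablesRel) : eulerWeightedEval g c = 0 := by
  have h0 : KZ.eval c = 0 := KZ.eval_eq_zero_of_mem_changeOfVariablesRel_holds hc
  obtain ⟨n, r, r', Φ, Φ', h1, -, h3, h4, -, rfl⟩ := hc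
  simp only [map_sub, KZ.eval_of, sub_eq_zero] at h0
  have hχ : realEuler n r'.domain = realEuler n r.domain := by
    rw [realEuler, realEuler, h4]
    exact hE isOMinimal_real definable_lt_real r.domain Φ (definable_univ_of_isSemialgebraic h1) h3
  simp only [map_sub, eulerWeightedEval_of, hχ, h0, sub_self]

/-- **Rules (1b), (2), (3) preserve `J_g`** (modulo (2.4)), for every weight `g`.
[cite: Dries1998, Ch. 4 (2.4)] -/
theorem closure_withoutDomainAdd_le_ker (hE : Dries1998_ch4_prop_2_4 Language.orderedRing ℝ) (g : ℤ → ℝ) :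
    AddSubgroup.closure (KZ.integrandAddRel ∪ KZ.changeOfVariablesRel ∪ KZ.newtonLeibnizRel) ≤
      (eulerWeightedEval g).ker := by
  rw [AddSubgroup.closure_le]
  rintro c ((hc | hc) | hc)
  · exact eulerWeightedEval_eq_zero_of_mem_integrandAddRel g hc
  · exact eulerWeightedEval_eq_zero_of_mem_changeOfVariablesRel hE g hc
  · exact eulerWeightedEval_eq_zero_of_mem_newtonLeibnizRel g hc

/-- Without rule (2) no fact is needed: rules (1b), (3) preserve `J_g` unconditionally. [folklore] -/
theorem closure_integrandAdd_newtonLeibniz_le_ker (g : ℤ → ℝ) :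
    AddSubgroup.closure (KZ.integrandAddRel ∪ KZ.newtonLeibnizRel) ≤ (eulerWeightedEval g).ker := by
  rw [AddSubgroup.closure_le]
  rintro c (hc | hc)
  · exact eulerWeightedEval_eq_zero_of_mem_integrandAddRel g hc
  · exact eulerWeightedEval_eq_zero_of_mem_newtonLeibnizRel g hc

end Summit.KontsevichZagierPeriods.XMapKernel.Negative
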